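import Summits.QuantumFields.YangMills.Theorems.BalabanUVNodesN12RootedForest
import Summits.QuantumFields.YangMills.Theorems.BalabanUVNodesN12TowerSiteGraphConnectedNestedLam
import HarnessLib

/-!
# BalabanUVNodes ∕ N12 — ROOTED SPANNING FORESTS AT A BOND-LEVEL DATUM `𝔅` and at PRINT's datum `lamBondsSeq Ω k` ([II] (2.3)): dag-n12-w3's `…N12RootedForest` RE-ROOTED at the
# print tower sites `R(𝔅, k) = {ι_j c₋, ι_j c₊ : j ≤ k, c ∈ 𝔅 j}` — (F1)(F2)(TREE), and the transversality of the forest slice modulo the connectivity letter (C)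

[Balaban1985Variational] = «[15]», (4) p. 278 (the residual group: `u = 1` ∕ central at the constrained representatives), (16)–(18) p. 280; [Balaban1985RegularSpaces] = «[6]», (1.14)
p. 78, (1.19) p. 79 (print's `Ax_k(𝔅_k, U₀)`); [Balaban1988Convergent] = «[III]», (2.2) p. 255, (2.13) pp. 256–257; [Balaban1984PropagatorsII] = «[II]», (2.3) p. 224 (`Λ_j` as the
DIFFERENCE of the bond sets: the inward connectors are NOT constrained, so their deep ends are NOT roots).

Cell `pub-ymgap` (HUMAN RULINGS D-0062 ∕ D-0149), WIDTH SEAT `pub-ymgap-dag-n12-w6` g24 (node N12 = [B15]; key K1⁹ `stmt-QuantumFields-27364`, `--kind proof --supports … --as helper`;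
count-neutral).  THEOREMS ONLY (0 `def`, 0 `instance`, 0 `sorry`); by name over dag-n12-w3's `…N12RootedForest` §1 — which is GENERIC IN THE ROOT SET (`exists_rootedForest (R) (hR)`,
`forest_F1`, `exists_root_eq_of_forest`) — and the definer's F0a `B15DeterminingSetsB` (`BDetSet`, `bondsDet`, `lamBondsSeq`, `lamBondsSeq_top`).  The first (F)-file of the (ii) split
(dag-n12-d g32 ∕ dag-n12-w6 g24, pub-ymgap INBOX 2026-08-30); also imports this seat's ✓p767987 `…TowerSiteGraphConnectedNestedLam` for §3: the forest ∕ orbit layer at print's datum has the SMALLER root set; everything downstream (`…ForestSlice*`, `…TowerForest*`,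
`…BjCollarRoots`, `…ForestOnto`) re-reads its roots from here.

WHY.  At print's datum the residual gauge group (4) is LARGER than at reading (b): a gauge transformation need only be `1` (central) at the tower sites of PRINT's bonds `lamBondsSeq Ω k j
⊆ bondsOf (genSet Ω k j)`; the deep ends of the inward connectors are free.  A tree gauge for that group is a rooted spanning forest with roots EXACTLY at the print tower sites — w3's
breadth-first forest at the smaller root set.  (F1) prefix∕orientation and (F2) roots are the two letters dag-n12-w6's `B15Prop1AxialGaugeSectionOfForest.exists_gaugeSection_of_forest`
consumes; (TREE) feeds the residual decomposition and the transversality §2, whose connectivity letter (C) at print's datum is exactly what this seat's ✓p767987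
`…TowerSiteGraphConnectedNestedLam` discharges for (N)(B)(S) sequences (its `T`-closed-set currency ⇒ the potential currency below by taking `T := {x | ψ x = ψ x₀}`; that one-line
bridge is §3: `hconn_lamBondsSeq_of_nested`, whence the letter-free `grad_eq_zero_of_forest_of_locConst_lamBondsSeq_nested`).

CONTENTS (namespace `Summit.QuantumFields.YangMills.BalabanUVNodes.N12RootedForestLam`): §1 bond datum: ★ `exists_rootedForest_bDetSet`, ★★ `grad_eq_zero_of_forest_of_locConst_bDetSet`,
`exists_rootedForest_bondsDet` (at `𝔅 := bondsDet 𝔹` the statement IS w3's `exists_rootedForest_detSet`, same root set); §2 print: ★ `exists_rootedForest_lamBondsSeq`,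
★ `exists_rootedForest_lamBondsSeq_of_mem_top` (`hne` from one `k`-site of `Ω_k^{(k)}`), ★★ `grad_eq_zero_of_forest_of_locConst_lamBondsSeq`; §3 (N)(B)(S): ★★ `hconn_lamBondsSeq_of_nested`
((C) in potential currency from ✓p767987's `T`-closed-set connectivity), ★★★ `grad_eq_zero_of_forest_of_locConst_lamBondsSeq_nested` (transversality with (C) DISCHARGED).

HONEST FRAMING.  Finite graph theory by name (BFS forest, root values); the honest tree gauge for print's residual group; nothing of Bałaban's estimates asserted or refuted; count-neutral
helper; N12 NOT discharged; K0⁷∕K1⁹ NOT closed; counts of record unmoved; one finite 𝕋⁴ programme at fixed ε — R4 closes the conditional rung `BalabanLadder.UV` only; the Yang–Mills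
mass gap (Clay) is NOT proved by any of this; nothing continuum ∕ ℝ⁴ ∕ OS.
-/

noncomputable section

namespace Summit.QuantumFields.YangMills.BalabanUVNodes.N12RootedForestLam

open Literature.MathematicalPhysics.QuantumFieldTheory.Balaban1983to89
open T4Continuum
open B15DeterminingSets B15DeterminingSetsB
open Summit.QuantumFields.YangMills.BalabanUVNodes.N12RootedForest (exists_rootedForest forest_F1 exists_root_eq_of_forest)
open Summit.QuantumFields.YangMills.BalabanUVNodes.N12TowerSiteGraphConnectedNestedLam (towerSite_mem_of_closed_lamBondsSeq)
open B14.Eq22Determines (blockIter IsBlockUnion)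

variable {P : Params}

/-! ## §1  The rooted forest and the transversality at a bond-level datum `𝔅` -/

section BondDatum

/-- ★ **THE ROOTED FOREST AT A BOND-LEVEL DATUM**: for `𝔅 : BDetSet P` read up to level `k` with at least one constrained bond, a rooted spanning forest of `T_η` with (F1) PREFIX∕ORIENTATION,
(F2) ROOTS at the tower sites `ι_j c₋`, `ι_j c₊` of every `c ∈ 𝔅 j`, `j ≤ k` — the two letters of `B15Prop1AxialGaugeSectionOfForest.exists_gaugeSection_of_forest` — and (TREE) every other
site hanging in it (w3's `exists_rootedForest` at the root set `R(𝔅, k)`). [cite: Balaban1985Variational, (4) p.278, (16)–(18) p.280; Balaban1985RegularSpaces, (1.14) p.78, (1.19) p.79; Balaban1988Convergent, (2.2) p.255] -/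
theorem exists_rootedForest_bDetSet (𝔅 : BDetSet P) (k : ℕ) (hne : ∃ j, j ≤ k ∧ ∃ c, c ∈ 𝔅 j) :
    ∃ path : Site P 0 → List (LStep P 0),
      (∀ x, ∀ s ∈ path x, ∃ x' x'' : Site P 0, path x'' = path x' ++ [s] ∧
        (s.fwd = true → s.bond.src = x' ∧ s.bond.tgt = x'') ∧ (s.fwd = false → s.bond.src = x'' ∧ s.bond.tgt = x')) ∧
      (∀ j, j ≤ k → ∀ c ∈ 𝔅 j, path (embIter j c.src) = [] ∧ path (embIter j c.tgt) = []) ∧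
      (∀ x : Site P 0, x ∉ {z : Site P 0 | ∃ j, j ≤ k ∧ ∃ c ∈ 𝔅 j, (z = embIter j c.src ∨ z = embIter j c.tgt)} →
        ∃ (x' : Site P 0) (s : LStep P 0), path x = path x' ++ [s] ∧
          (s.fwd = true → s.bond.src = x' ∧ s.bond.tgt = x) ∧ (s.fwd = false → s.bond.src = x ∧ s.bond.tgt = x')) := by
  obtain ⟨j, hj, c, hc⟩ := hne
  obtain ⟨path, hroot, htree⟩ := exists_rootedForest
    {z : Site P 0 | ∃ j, j ≤ k ∧ ∃ c ∈ 𝔅 j, (z = embIter j c.src ∨ z = embIter j c.tgt)} ⟨embIter j c.src, j, hj, c, hc, Or.inl rfl⟩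
  exact ⟨path, forest_F1 hroot htree, fun j hj c hc => ⟨hroot _ ⟨j, hj, c, hc, Or.inl rfl⟩, hroot _ ⟨j, hj, c, hc, Or.inr rfl⟩⟩, htree⟩

variable {V : Type*}

/-- ★★ **TRANSVERSALITY OF THE FOREST SLICE AT A BOND-LEVEL DATUM, MODULO THE CONNECTIVITY LETTER (C).**  Roots: the tower sites `R(𝔅, k)`.  If every non-root hangs in the forest (TREE), a
potential `φ` that is constant along every constrained bond at the tower sites (`hconst`) and constant along every path bond (`hax`: its gradient lies in the forest slice) is constant:
`dφ = 0` — every site carries the value of its root, a root value is a constrained source value, and (C) identifies all of those (w3's :244, re-rooted).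
[cite: Balaban1985Variational, (4) p.278; Balaban1985RegularSpaces, (1.14) p.78, (1.19) p.79; Balaban1988Convergent, (2.2) p.255, (2.13) pp.256–257] -/
theorem grad_eq_zero_of_forest_of_locConst_bDetSet [AddCommGroup V] (𝔅 : BDetSet P) (k : ℕ) {path : Site P 0 → List (LStep P 0)}
    (htree : ∀ x : Site P 0, x ∉ {z : Site P 0 | ∃ j, j ≤ k ∧ ∃ c ∈ 𝔅 j, (z = embIter j c.src ∨ z = embIter j c.tgt)} →
      ∃ (x' : Site P 0) (s : LStep P 0), path x = path x' ++ [s] ∧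
        (s.fwd = true → s.bond.src = x' ∧ s.bond.tgt = x) ∧ (s.fwd = false → s.bond.src = x ∧ s.bond.tgt = x'))
    (hconn : ∀ ψ : Site P 0 → V, (∀ j, j ≤ k → ∀ c ∈ 𝔅 j, ψ (embIter j c.tgt) = ψ (embIter j c.src)) →
      ∀ j j', j ≤ k → j' ≤ k → ∀ c ∈ 𝔅 j, ∀ c' ∈ 𝔅 j', ψ (embIter j c.src) = ψ (embIter j' c'.src))
    (φ : Site P 0 → V) (hconst : ∀ j, j ≤ k → ∀ c ∈ 𝔅 j, φ (embIter j c.tgt) = φ (embIter j c.src))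
    (hax : ∀ x, ∀ s ∈ path x, φ s.bond.tgt = φ s.bond.src) :
    ∀ b : PBond P 0, φ b.tgt - φ b.src = 0 := by
  have hsrc : ∀ x : Site P 0, ∃ j, j ≤ k ∧ ∃ c ∈ 𝔅 j, φ x = φ (embIter j c.src) := fun x => by
    obtain ⟨r, ⟨j, hj, c, hc, hrc⟩, hφ⟩ := exists_root_eq_of_forest htree φ hax x
    refine ⟨j, hj, c, hc, ?_⟩
    rcases hrc with rfl | rfl
    · exact hφ
    · exact hφ.trans (hconst j hj c hc)
  intro b
  obtain ⟨j, hj, c, hc, ht⟩ := hsrc b.tgt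
  obtain ⟨j', hj', c', hc', hs⟩ := hsrc b.src
  rw [ht, hs, sub_eq_zero]
  exact hconn φ hconst j j' hj hj' c hc c' hc'

/-- At the (b)-instance `𝔅 := bondsDet 𝐁` the bond-datum forest IS w3's `exists_rootedForest_detSet` (same root set; `bondsDet 𝐁 j = bondsOf (𝐁 j)` definitionally).
[cite: Balaban1988Convergent, (2.2) p.255 (bookkeeping)] -/
theorem exists_rootedForest_bondsDet (𝔹 : DetSet P) (k : ℕ) (hne : ∃ j, j ≤ k ∧ ∃ c, c ∈ bondsOf (𝔹 j)) :
    ∃ path : Site P 0 → List (LStep P 0),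
      (∀ x, ∀ s ∈ path x, ∃ x' x'' : Site P 0, path x'' = path x' ++ [s] ∧
        (s.fwd = true → s.bond.src = x' ∧ s.bond.tgt = x'') ∧ (s.fwd = false → s.bond.src = x'' ∧ s.bond.tgt = x')) ∧
      (∀ j, j ≤ k → ∀ c ∈ bondsDet 𝔹 j, path (embIter j c.src) = [] ∧ path (embIter j c.tgt) = []) ∧
      (∀ x : Site P 0, x ∉ {z : Site P 0 | ∃ j, j ≤ k ∧ ∃ c ∈ bondsDet 𝔹 j, (z = embIter j c.src ∨ z = embIter j c.tgt)} →
        ∃ (x' : Site P 0) (s : LStep P 0), path x = path x' ++ [s] ∧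
          (s.fwd = true → s.bond.src = x' ∧ s.bond.tgt = x) ∧ (s.fwd = false → s.bond.src = x ∧ s.bond.tgt = x')) :=
  exists_rootedForest_bDetSet (bondsDet 𝔹) k hne

end BondDatum

/-! ## §2  PRINT's datum `lamBondsSeq Ω k`: roots at the print tower sites only -/

section Print

variable {Ω : ℕ → Set (Site P 0)} {k : ℕ}

/-- ★ **THE ROOTED FOREST AT PRINT's DATUM** `lamBondsSeq Ω k` ([II] (2.3)): (F1), (F2) roots at `ι_j c±` for every PRINT bond `c ∈ lamBondsSeq Ω k j`, `j ≤ k` (the deep ends of the inward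
connectors are NOT roots), (TREE) — given one print bond (`hne`). [cite: Balaban1984PropagatorsII, (2.3) p.224; Balaban1985Variational, (4) p.278; Balaban1985RegularSpaces, (1.14) p.78, (1.19) p.79] -/
theorem exists_rootedForest_lamBondsSeq (hne : ∃ j, j ≤ k ∧ ∃ c, c ∈ lamBondsSeq Ω k j) :
    ∃ path : Site P 0 → List (LStep P 0),
      (∀ x, ∀ s ∈ path x, ∃ x' x'' : Site P 0, path x'' = path x' ++ [s] ∧
        (s.fwd = true → s.bond.src = x' ∧ s.bond.tgt = x'') ∧ (s.fwd = false → s.bond.src = x'' ∧ s.bond.tgt = x')) ∧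
      (∀ j, j ≤ k → ∀ c ∈ lamBondsSeq Ω k j, path (embIter j c.src) = [] ∧ path (embIter j c.tgt) = []) ∧
      (∀ x : Site P 0, x ∉ {z : Site P 0 | ∃ j, j ≤ k ∧ ∃ c ∈ lamBondsSeq Ω k j, (z = embIter j c.src ∨ z = embIter j c.tgt)} →
        ∃ (x' : Site P 0) (s : LStep P 0), path x = path x' ++ [s] ∧
          (s.fwd = true → s.bond.src = x' ∧ s.bond.tgt = x) ∧ (s.fwd = false → s.bond.src = x ∧ s.bond.tgt = x')) :=
  exists_rootedForest_bDetSet (lamBondsSeq Ω k) k hne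

/-- ★ **… WITH THE NONEMPTINESS ROW DISCHARGED FROM ONE TOP-LEVEL SITE**: if `Ω_k^{(k)}` has a `k`-site `y`, the bond `⟨y, 0⟩` meets `Ω_k^{(k)}` and at the top level print excludes nothing
(`lamBondsSeq_top`), so print's root set is nonempty. [cite: Balaban1984PropagatorsII, (2.3) p.224; Balaban1988Convergent, (2.2) p.255] -/
theorem exists_rootedForest_lamBondsSeq_of_mem_top {y : Site P k} (hy : y ∈ pts k (Ω k)) :
    ∃ path : Site P 0 → List (LStep P 0),
      (∀ x, ∀ s ∈ path x, ∃ x' x'' : Site P 0, path x'' = path x' ++ [s] ∧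
        (s.fwd = true → s.bond.src = x' ∧ s.bond.tgt = x'') ∧ (s.fwd = false → s.bond.src = x'' ∧ s.bond.tgt = x')) ∧
      (∀ j, j ≤ k → ∀ c ∈ lamBondsSeq Ω k j, path (embIter j c.src) = [] ∧ path (embIter j c.tgt) = []) ∧
      (∀ x : Site P 0, x ∉ {z : Site P 0 | ∃ j, j ≤ k ∧ ∃ c ∈ lamBondsSeq Ω k j, (z = embIter j c.src ∨ z = embIter j c.tgt)} →
        ∃ (x' : Site P 0) (s : LStep P 0), path x = path x' ++ [s] ∧
          (s.fwd = true → s.bond.src = x' ∧ s.bond.tgt = x) ∧ (s.fwd = false → s.bond.src = x ∧ s.bond.tgt = x')) := by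
  refine exists_rootedForest_lamBondsSeq ⟨k, le_rfl, ⟨y, ⟨0, P.hd⟩⟩, ?_⟩
  rw [lamBondsSeq_top]
  exact Or.inl hy

variable {V : Type*}

/-- ★★ **TRANSVERSALITY OF THE PRINT-ROOTED FOREST SLICE, MODULO THE CONNECTIVITY LETTER (C) ON PRINT's BONDS**: with roots at the print tower sites, a potential constant along every
print bond at the tower sites and along every path bond is constant — given (C) «a potential constant along every print bond takes one value at all print tower sites» (for (N)(B)(S)
sequences: this seat's `…TowerSiteGraphConnectedNestedLam`, `T`-closed-set currency). [cite: Balaban1984PropagatorsII, (2.3) p.224; Balaban1985Variational, (4) p.278; Balaban1985RegularSpaces, (1.19) p.79; Balaban1988Convergent, (2.13) pp.256–257] -/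
theorem grad_eq_zero_of_forest_of_locConst_lamBondsSeq [AddCommGroup V] {path : Site P 0 → List (LStep P 0)}
    (htree : ∀ x : Site P 0, x ∉ {z : Site P 0 | ∃ j, j ≤ k ∧ ∃ c ∈ lamBondsSeq Ω k j, (z = embIter j c.src ∨ z = embIter j c.tgt)} →
      ∃ (x' : Site P 0) (s : LStep P 0), path x = path x' ++ [s] ∧
        (s.fwd = true → s.bond.src = x' ∧ s.bond.tgt = x) ∧ (s.fwd = false → s.bond.src = x ∧ s.bond.tgt = x'))
    (hconn : ∀ ψ : Site P 0 → V, (∀ j, j ≤ k → ∀ c ∈ lamBondsSeq Ω k j, ψ (embIter j c.tgt) = ψ (embIter j c.src)) →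
      ∀ j j', j ≤ k → j' ≤ k → ∀ c ∈ lamBondsSeq Ω k j, ∀ c' ∈ lamBondsSeq Ω k j', ψ (embIter j c.src) = ψ (embIter j' c'.src))
    (φ : Site P 0 → V) (hconst : ∀ j, j ≤ k → ∀ c ∈ lamBondsSeq Ω k j, φ (embIter j c.tgt) = φ (embIter j c.src))
    (hax : ∀ x, ∀ s ∈ path x, φ s.bond.tgt = φ s.bond.src) :
    ∀ b : PBond P 0, φ b.tgt - φ b.src = 0 :=
  grad_eq_zero_of_forest_of_locConst_bDetSet (lamBondsSeq Ω k) k htree hconn φ hconst hax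

end Print

/-! ## §3  (N)(B)(S) sequences: the connectivity letter (C) on print's bonds DISCHARGED (this seat's `…TowerSiteGraphConnectedNestedLam`) -/

section Nested

variable {Ω : ℕ → Set (Site P 0)} {k : ℕ} {V : Type*}

/-- ★★ **THE CONNECTIVITY LETTER (C) ON PRINT's BONDS, IN POTENTIAL CURRENCY, FOR EVERY (N)(B)(S) SEQUENCE** (`1 ≤ k ≤ m + K`): a potential `ψ` equal at the two tower sites of every print
bond takes ONE value at all print tower sites — ✓p767987's `towerSite_mem_of_closed_lamBondsSeq` read at the `ψ`-level set `T := {x | ψ x = ψ (ι_{j'} c'₋)}` (closed under print's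
bonds because `ψ` agrees at their ends). [cite: Balaban1984PropagatorsII, (2.3) p.224; Balaban1988Convergent, (2.2) p.255, (2.13) pp.256–257; Balaban1985RegularSpaces, (1.3)–(1.6) p.77] -/
theorem hconn_lamBondsSeq_of_nested (hk1 : 1 ≤ k) (hk : k ≤ P.m + P.K) (hnest : ∀ j, 1 ≤ j → j < k → Ω (j + 1) ⊆ Ω j)
    (hBU : ∀ j, 1 ≤ j → j ≤ k → IsBlockUnion j (Ω j))
    (hsep : ∀ j, 1 ≤ j → j + 1 ≤ k → ∀ (x z : Site P 0) (μ : Fin P.d), (z = x.shift μ ∨ x = z.shift μ) → z ∈ Ω (j + 1) →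
      ∀ y : Site P 0, blockIter (j + 1) y = blockIter (j + 1) x → y ∈ Ω j)
    (ψ : Site P 0 → V) (hψ : ∀ j, j ≤ k → ∀ c ∈ lamBondsSeq Ω k j, ψ (embIter j c.tgt) = ψ (embIter j c.src)) :
    ∀ j j', j ≤ k → j' ≤ k → ∀ c ∈ lamBondsSeq Ω k j, ∀ c' ∈ lamBondsSeq Ω k j', ψ (embIter j c.src) = ψ (embIter j' c'.src) := by
  intro j j' hj hj' c hc c' hc'
  have h := towerSite_mem_of_closed_lamBondsSeq hk1 hk hnest hBU hsep {x | ψ x = ψ (embIter j' c'.src)}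
    (fun i hi b hb => by
      show ψ (embIter i b.src) = ψ (embIter j' c'.src) ↔ ψ (embIter i b.tgt) = ψ (embIter j' c'.src)
      rw [hψ i hi b hb])
    hj' hc' rfl hj hc
  exact h

/-- ★★★ **TRANSVERSALITY OF THE PRINT-ROOTED FOREST SLICE FOR EVERY (N)(B)(S) SEQUENCE, LETTER-FREE**: roots at the print tower sites; a potential constant along every print bond at the
tower sites and along every path bond has zero gradient — §2 with (C) discharged by `hconn_lamBondsSeq_of_nested`.  This is the uniqueness-of-the-gauge half of the forest slice at print's
datum: no non-zero locally-constant direction survives the print tree gauge. [cite: Balaban1984PropagatorsII, (2.3) p.224; Balaban1985Variational, (4) p.278; Balaban1985RegularSpaces, (1.19) p.79; Balaban1988Convergent, (2.13) pp.256–257] -/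
theorem grad_eq_zero_of_forest_of_locConst_lamBondsSeq_nested [AddCommGroup V] (hk1 : 1 ≤ k) (hk : k ≤ P.m + P.K)
    (hnest : ∀ j, 1 ≤ j → j < k → Ω (j + 1) ⊆ Ω j) (hBU : ∀ j, 1 ≤ j → j ≤ k → IsBlockUnion j (Ω j))
    (hsep : ∀ j, 1 ≤ j → j + 1 ≤ k → ∀ (x z : Site P 0) (μ : Fin P.d), (z = x.shift μ ∨ x = z.shift μ) → z ∈ Ω (j + 1) →
      ∀ y : Site P 0, blockIter (j + 1) y = blockIter (j + 1) x → y ∈ Ω j)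
    {path : Site P 0 → List (LStep P 0)}
    (htree : ∀ x : Site P 0, x ∉ {z : Site P 0 | ∃ j, j ≤ k ∧ ∃ c ∈ lamBondsSeq Ω k j, (z = embIter j c.src ∨ z = embIter j c.tgt)} →
      ∃ (x' : Site P 0) (s : LStep P 0), path x = path x' ++ [s] ∧
        (s.fwd = true → s.bond.src = x' ∧ s.bond.tgt = x) ∧ (s.fwd = false → s.bond.src = x ∧ s.bond.tgt = x'))
    (φ : Site P 0 → V) (hconst : ∀ j, j ≤ k → ∀ c ∈ lamBondsSeq Ω k j, φ (embIter j c.tgt) = φ (embIter j c.src))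
    (hax : ∀ x, ∀ s ∈ path x, φ s.bond.tgt = φ s.bond.src) :
    ∀ b : PBond P 0, φ b.tgt - φ b.src = 0 :=
  grad_eq_zero_of_forest_of_locConst_lamBondsSeq htree (fun ψ hψ => hconn_lamBondsSeq_of_nested hk1 hk hnest hBU hsep ψ hψ) φ hconst hax

end Nested

end Summit.QuantumFields.YangMills.BalabanUVNodes.N12RootedForestLam

end
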